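import Literature.MathematicalPhysics.QuantumFieldTheory.Balaban1983to89.B3GkZeroBoxSeparated
import Literature.MathematicalPhysics.QuantumFieldTheory.Balaban1983to89.B3Sect3Statements
import Literature.MathematicalPhysics.QuantumFieldTheory.Balaban1983to89.B3Sect1Statements

/-!
# `Balaban1983to89.B3Ineq31ZeroBox` — T. Bałaban, *(Higgs)₂,₃ quantum fields in a finite volume. III. Renormalization*,
# Commun. Math. Phys. **88** (1983) 411–445 [Balaban1983Higgs3], (3.1) p. 432:
# `‖hG_k(Ω,B̃)h′‖_{1,α} ≤ O(1)e^{−δ₀dist(□(v),□(v′))}`, PROVED for the MODEL INSTANCE `A = B̃ = 0`, `Ω = □` a rectangular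
# parallelepiped, `h, h′` the unit-cube localizations of p. 420, `‖·‖_{1,α}` the printed norm (1.32) of the two-variable field
# `(x,x′) ↦ G^η_k(□,0;x,x′)` on `□(v) × □(v′)` — `Sect3Data.Ineq31 α δ₀ C` DISCHARGED for the concrete carrier `sect3ZeroBox`,
# for each `0 ≤ α < 1`, every scale `k ≥ 1`, every window point and every box

statement-level skeleton of published theorems with citation tags; proofs where landed; nothing here is a claim about the Yang–Mills mass gap

PDF held: `paper:balaban1983-higgs-2-3-quantum-fields-finite-volume` (journal page = PDF page + 410); p. 420 [PDF 10] ((1.32), the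
localizations), p. 424 [PDF 14] ((2.5), (2.6)), p. 432 [PDF 22] ((3.1)) read in the OCR text (`p0010.txt`, `p0014.txt`, `p0022.txt`).

CITATION HEADER (lean-in-tree rule).  Part of the lit-balaban TYPED SKELETON (HOME `run/shared/lean/pub/lit-balaban/`), Phase 2:
SKELETON row **B3.Eq3.1** (`HOME/lit-balaban-r15/ROWS-B3.md`, fold owner r15; decl of record `B3Sect3Statements.Sect3Data.Ineq31`,
typed p239220 over the ABSTRACT carrier `Sect3Data`); file 2 of 2 of the member «MODEL INSTANCE A = B̃ = 0, Ω = □» (file 1 =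
`B3GkZeroBoxSeparated`, p256156: the kernel estimates at separated arguments); companion of `B3Ineq210ZeroBox` /
`B3Ineq212ZeroBox` / `B3Ineq211ZeroBox` (rows B3.Eq2.10–2.12), whose instance this is.

WHAT IS PRINTED.  (3.1) p. 432 [PDF 22]: *"Now if two vertices, v, v′ have localizations satisfying dist(□(v), □(v′)) ≥ 1, then we
consider every propagator corresponding to a line connecting these vertices as an external field also. Such a possibility is
assured by the following estimates ‖hG_k(Ω,B̃)h′‖_{1,α} ≤ O(1)e^{−δ₀dist(□(v),□(v′))}, (3.1) and similarly for the vector field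
propagator, h, h′ are localization functions."*  (1.32) p. 420 [PDF 10]: *"For a scalar field f of one variable we define
‖f‖_{1,α} = sup_x |f(x)| + sup_{x,μ} |(D^η_{B,μ}f)(x)| + sup_{x,x′,μ} |x − x′|^{−α}|U(B(Γ_{x,x′}))(D^η_{B,μ}f)(x′) − (D^η_{B,μ}f)(x)|, (1.32)
where Γ_{x,x′} is a shortest contour connecting x and x′. This definition extends in a natural way to functions of many
variables. For external vector fields we have the same definition, but with B = 0. The next thing we need is a further
localization in the vertices. For the vertices (1.6) and (1.7) we localize simply by representing Ω₁ as a sum of unit cubes of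
the [unit] lattice."*

WHAT IS REPRODUCED, and how (kind «model-instance», G.1 of `HOME/PHASE2-TARGETS.md`).
* §1 the unit cubes `□(v) = {x : ⌊x/L^k⌋ = v}` of fine sites (`B4Reflection242.blk`), `dist(□(v),□(v′)) = max(|v − v′|_∞ − 1, 0)`
  (`cubeDist`), and the separation of their points: `L^k·dist(□(v),□(v′)) ≤ |x − x′|_∞` (`cubeDist_mul_le_supNorm`, from the
  lower block bound `b(|blk x − blk x′|_∞ − 1) ≤ |x − x′|_∞`).
* §2 a lattice PATH LEMMA (`abs_sub_le_l1`/`abs_sub_le_supNorm`, private): on a box-convex set of `ℤ^{d+1}` (e.g. the fine sites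
  of a cube, `boxConvex_cube`) nearest-neighbour differences `≤ B` give `|g(y₂) − g(y₁)| ≤ B·|y₂ − y₁|₁ ≤ B(d+1)|y₂ − y₁|_∞`.
* §3 the objects of (3.1) for the instance: the two-variable field `kerF (x,x′) = G^η_k(□,0;x,x′) = (L^k)^{d+1}·Gfine ℓ k M k a m2 x x′`
  on the product lattice `□ × □`; the localization domain `sites v v′ = □(v) × □(v′)`; the product-lattice bonds `bonds v v′` in
  the `2(d+1)` directions (row bonds `(μ,(x,x′),x+e_μ)`, column bonds `(ν,(x,x′),x′+e_ν)`, both ends in the domain) carrying the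
  lattice derivatives `derivF = η^{−1}Δ F` (`U ≡ 1`); `normHGH α v v′` = the printed SUM form (1.32) `B3Sect1Statements.norm132` of
  `(kerF, derivF)` over `(sites, bonds)` with same-direction bond pairs admissible and the product sup-distance `pdist` in
  `η`-units; and the CARRIER `sect3ZeroBox ℓ k M a m2 : Sect3Data` with `LocFn = ℤ^{d+1}` (the cubes), `distCubes = cubeDist`,
  `normHGH` as above, the (3.2)–(3.5) data NOT modelled (`RenClass′ = ∅`; `Ineq32/Ineq33/Claim35` vacuous, nothing claimed);
  `ineq31_iff` (`Iff.rfl`).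
* §4 the three parts of (1.32) from kernel clauses at separation `ρ = 1` (hypotheses of the exact shape produced by
  `B3GkZeroBoxSeparated`): `supPart_le` (value clause), `derivPart_le` (row/column derivative clauses), **`holderPart_le`** (for two
  same-direction bonds split the difference of derivatives at the intermediate bond: same differentiated variable → the Hölder
  clause with the weight `(L^k/|x₂−x₁|)^α` removed; other variable → the path lemma inside the cube with steps bounded by the MIXED
  clause when `η|Δ| ≤ 1` (`t ≤ t^α`), twice the derivative sup when `η|Δ| > 1` (`1 ≤ t^α`)).
* §5 **`ineq31_zeroBox`**: `∀ α ∈ [0,1) ∃ δ₀ C > 0 ∀ k ≥ 1, window point, box: (sect3ZeroBox ℓ k M a m2).Ineq31 α δ₀ C`, with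
  `δ₀ = min` of the six kernel rates and `C` the sum of the part constants; §6 a non-vacuity witness.

HONEST SCOPE / DECLARED DIVERGENCES (F7).  (i) Only `A = B̃ = 0` (`U(B̃(Γ)) ≡ 1`, one component), `Ω = □` a box of unit blocks
with Neumann conditions, `k ≥ 1`, running constants in a window; not general `Ω`, not the torus; only the SCALAR propagator
`G_k` («similarly for the vector field propagator» not covered); not `δG_k(Ω,Ω₂,B̃)` / (2.5).  (ii) LOCALIZATION FUNCTIONS: `h, h′`
are the INDICATORS of two unit cubes `□(v), □(v′)` of the `L^kη = 1` lattice (p. 420, the localization of the scalar vertices);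
the norm of the localized two-variable field is taken OVER ITS LOCALIZATION DOMAIN `□(v) × □(v′)` (sites and bonds inside it) — the
smooth partitions of unity the print uses for vector legs / external fields (supports in cubes of side 2, `h = 1` on `□(v)`) are
NOT modelled here (they would add the bounded `∂h`-terms of the Leibniz rule; the kernel inputs for that, at any separation
`ρ > 0`, are in file 1).  (iii) «extends in a natural way to functions of many variables» is READ as: the same formula on the
product lattice `(ηℤ)^{2(d+1)}` — sup over the domain, sup of the lattice derivatives in all `2(d+1)` directions, and the sup of
the Hölder quotients `|∂F(b′) − ∂F(b)|/|z(b) − z(b′)|^α` over pairs of bonds with the SAME direction and distinct base points, the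
distance of base points being the sup-distance of the product lattice in `η`-units (the print fixes neither the norm on `ℤ^{2(d+1)}`
nor Euclidean vs sup; other choices change constants only).  (iv) `dist(□(v),□(v′))` = sup-distance of the closed unit cubes.
(v) QUANTIFIERS/CONSTANTS: `∀ α ∈ [0,1) ∃ (δ₀, C)`, uniform in `k`, the box, the cubes and the window point, NOT uniform in `α`
(as for (2.11), G-B3-11: the print's O(1) is at the paper's fixed `α`); constants existential.  (vi) ROUTE = the print's («assured by
the following estimates» = the propagator bounds of [B4]/Props. I.2.1–I.2.3 behind (2.10)–(2.11)), through the kernel-proved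
`A = 0` box lineage used BY NAME (`B3GkZeroBoxSeparated` ← `B3Ineq210ZeroBox`, `B3Ineq211ZeroBox`, `B4Thm110ZeroBox(Deriv)`,
`B4Thm19ZeroBoxHolder`, `B4BoxCov237`); no Literature fact minted (`sect3ZeroBox` is a concrete `def`, the theorems are proved);
standard axioms.  Value = kernel certificate of a located by-reference step of B3 for the zero-background box instance, NOT
summit progress.
Unit `lit-balaban-p03-g4` (Phase-2 proof seat p03, gen 4); HOME `run/shared/lean/pub/lit-balaban/` (row B3.Eq3.1, FILED.md, STATUS.md).
-/

namespace Literature.MathematicalPhysics.QuantumFieldTheory.Balaban1983to89.B3Ineq31ZeroBox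

open Finset Matrix
open Literature.MathematicalPhysics.QuantumFieldTheory.Balaban1983to89.B4ContourShift
open Literature.MathematicalPhysics.QuantumFieldTheory.Balaban1983to89.B4Reflection242
open Literature.MathematicalPhysics.QuantumFieldTheory.Balaban1983to89.B4BoxCov237
open Literature.MathematicalPhysics.QuantumFieldTheory.Balaban1983to89.B4Thm110ZeroBox
open Literature.MathematicalPhysics.QuantumFieldTheory.Balaban1983to89.B4Thm110ZeroBoxDeriv
open Literature.MathematicalPhysics.QuantumFieldTheory.Balaban1983to89.B3Ineq210ZeroBox
open Literature.MathematicalPhysics.QuantumFieldTheory.Balaban1983to89.B3GkZeroBoxSeparated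
open Literature.MathematicalPhysics.QuantumFieldTheory.Balaban1983to89.B3Sect3Statements
open Literature.MathematicalPhysics.QuantumFieldTheory.Balaban1983to89.B3Sect1Statements (norm132 norm132_nonneg)

noncomputable section

variable {d : ℕ}

/-! ## §1 Lattice geometry of the unit-cube localizations `□(v) = {x ∈ ηℤ^{d+1} ∩ □ : ⌊x/L^k⌋ = v}` -/

/-- `dist(□(v), □(v′))` for the closed unit cubes with integer corners `v, v′` (sup-distance): `max(|v − v′|_∞ − 1, 0)`.
[cite: Balaban1983Higgs3, (3.1) p.432] -/
def cubeDist (v v' : Fin (d + 1) → ℤ) : ℝ := max (supNorm (v - v') - 1) 0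

/-- `dist(□(v), □(v′)) ≥ 0`. [cite: Balaban1983Higgs3, (3.1) p.432] -/
theorem cubeDist_nonneg (v v' : Fin (d + 1) → ℤ) : 0 ≤ cubeDist v v' := le_max_right _ _

/-- kernel: **points of two `b`-blocks are at least `b(|β − β′|_∞ − 1)` apart** (`β = blk_b x`, `β′ = blk_b x′`) — the lower
companion of `B4Thm110ZeroBox.supNorm_sub_le_blk`. [folklore] -/
private theorem blk_sub_le_supNorm_sub {b : ℕ} (hb : 1 ≤ b) (x x' : Fin (d + 1) → ℤ) :
    (b : ℝ) * (supNorm (blk b x - blk b x') - 1) ≤ supNorm (x - x') := by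
  have hb0 : (0 : ℤ) < b := by exact_mod_cast hb
  obtain ⟨i, hi⟩ := exists_supNorm_eq (blk b x - blk b x')
  rw [hi]
  have h1 : x i % (b : ℤ) + x i / (b : ℤ) * b = x i := Int.emod_add_ediv_mul (x i) b
  have h2 : x' i % (b : ℤ) + x' i / (b : ℤ) * b = x' i := Int.emod_add_ediv_mul (x' i) b
  have h3 : 0 ≤ x i % (b : ℤ) := Int.emod_nonneg (x i) hb0.ne'
  have h4 : x i % (b : ℤ) < b := Int.emod_lt_of_pos (x i) hb0
  have h5 : 0 ≤ x' i % (b : ℤ) := Int.emod_nonneg (x' i) hb0.ne'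
  have h6 : x' i % (b : ℤ) < b := Int.emod_lt_of_pos (x' i) hb0
  have hβ' : (blk b x - blk b x') i = x i / (b : ℤ) - x' i / (b : ℤ) := rfl
  have h7 : (b : ℤ) * (|x i / (b : ℤ) - x' i / (b : ℤ)| - 1) ≤ |x i - x' i| := by
    have e : x i - x' i
        = (b : ℤ) * (x i / (b : ℤ) - x' i / (b : ℤ)) + (x i % (b : ℤ) - x' i % (b : ℤ)) := by
      linear_combination -h1 + h2
    rw [e]
    have hr : |x i % (b : ℤ) - x' i % (b : ℤ)| ≤ (b : ℤ) - 1 := by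
      rw [abs_le]; constructor <;> omega
    have t := abs_sub_abs_le_abs_sub ((b : ℤ) * (x i / (b : ℤ) - x' i / (b : ℤ))) (-(x i % (b : ℤ) - x' i % (b : ℤ)))
    rw [sub_neg_eq_add, abs_neg, abs_mul, abs_of_pos hb0] at t
    nlinarith [abs_nonneg (x i / (b : ℤ) - x' i / (b : ℤ))]
  have h8 : (((|x i - x' i| : ℤ)) : ℝ) ≤ supNorm (x - x') := abs_le_supNorm (x - x') i
  have h9 : ((b : ℤ) : ℝ) * ((((|x i / (b : ℤ) - x' i / (b : ℤ)| : ℤ)) : ℝ) - 1) ≤ (((|x i - x' i| : ℤ)) : ℝ) := by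
    exact_mod_cast h7
  rw [hβ']
  push_cast at h8 h9 ⊢
  linarith

/-- For fine sites `x ∈ □(v)`, `x′ ∈ □(v′)` (`⌊x/L^k⌋ = v`, `⌊x′/L^k⌋ = v′`): `η|x − x′|_∞ ≥ dist(□(v), □(v′))`, i.e.
`L^k·dist(□(v),□(v′)) ≤ |x − x′|_∞`. [cite: Balaban1983Higgs3, (3.1) p.432] -/
theorem cubeDist_mul_le_supNorm {b : ℕ} (hb : 1 ≤ b) {x x' v v' : Fin (d + 1) → ℤ} (hx : blk b x = v) (hx' : blk b x' = v') :
    (b : ℝ) * cubeDist v v' ≤ supNorm (x - x') := by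
  unfold cubeDist
  rcases le_total (supNorm (v - v') - 1) 0 with h | h
  · rw [max_eq_right h, mul_zero]; exact supNorm_nonneg _
  · rw [max_eq_left h, ← hx, ← hx']; exact blk_sub_le_supNorm_sub hb x x'

/-! ## §2 A lattice path lemma: a function on a box-convex set of `ℤ^{d+1}` whose nearest-neighbour differences are `≤ B`
varies by at most `B·|y₂ − y₁|₁ ≤ B(d+1)|y₂ − y₁|_∞` -/

/-- A set of lattice points is BOX-CONVEX if with two points it contains every point between them coordinatewise
(products of integer intervals — the fine sites of a cube `□(v′) ∩ □` — are such). [folklore] -/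
private def BoxConvex (P : (Fin (d + 1) → ℤ) → Prop) : Prop :=
  ∀ y₁ y₂, P y₁ → P y₂ → ∀ y : Fin (d + 1) → ℤ, (∀ i, min (y₁ i) (y₂ i) ≤ y i ∧ y i ≤ max (y₁ i) (y₂ i)) → P y

/-- kernel: the `ℓ¹` size of a lattice vector as a natural number. [folklore] -/
private def l1 (z : Fin (d + 1) → ℤ) : ℕ := ∑ i, (z i).natAbs

/-- kernel: `Σ_i |z_i| ≤ (d+1)|z|_∞`. [folklore] -/
private theorem l1_le_supNorm (z : Fin (d + 1) → ℤ) : ((l1 z : ℕ) : ℝ) ≤ ((d : ℝ) + 1) * supNorm z := by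
  unfold l1
  push_cast
  have h : ∀ i ∈ (univ : Finset (Fin (d + 1))), (((z i).natAbs : ℤ) : ℝ) ≤ supNorm z := fun i _ => by
    rw [Int.natCast_natAbs]; exact abs_le_supNorm z i
  calc ∑ i, (((z i).natAbs : ℤ) : ℝ) ≤ ∑ _i : Fin (d + 1), supNorm z := sum_le_sum h
    _ = ((d : ℝ) + 1) * supNorm z := by rw [sum_const, card_univ, Fintype.card_fin, nsmul_eq_mul]; push_cast; ring

/-- kernel: **the path lemma** — on a box-convex set, nearest-neighbour differences `≤ B` give `|g(y₂) − g(y₁)| ≤ B·Σ_i|y₂ᵢ − y₁ᵢ|`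
(telescoping along a staircase path that stays in the set). [folklore] -/
private theorem abs_sub_le_l1 {P : (Fin (d + 1) → ℤ) → Prop} (hP : BoxConvex P) (g : (Fin (d + 1) → ℤ) → ℝ) {B : ℝ}
    (hstep : ∀ (y : Fin (d + 1) → ℤ) (i : Fin (d + 1)), P y → P (y + Pi.single i 1) →
      |g (y + Pi.single i 1) - g y| ≤ B) :
    ∀ (n : ℕ) (y₁ y₂ : Fin (d + 1) → ℤ), l1 (y₂ - y₁) = n → P y₁ → P y₂ → |g y₂ - g y₁| ≤ B * n := by
  intro n
  induction n with
  | zero =>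
    intro y₁ y₂ hn _ _
    have h0 : y₂ = y₁ := by
      have h : ∀ i, (y₂ - y₁) i = 0 := by
        intro i
        have := (Finset.sum_eq_zero_iff.1 hn) i (mem_univ i)
        exact Int.natAbs_eq_zero.1 this
      funext i; have := h i; simp only [Pi.sub_apply] at this; linarith
    subst h0
    simp
  | succ n ih =>
    intro y₁ y₂ hn hy₁ hy₂
    -- a coordinate in which `y₁` and `y₂` differ
    have hex : ∃ i, (y₂ - y₁) i ≠ 0 := by
      by_contra h
      push Not at h
      have : l1 (y₂ - y₁) = 0 := Finset.sum_eq_zero fun i _ => by rw [h i]; rfl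
      omega
    obtain ⟨i, hi⟩ := hex
    simp only [Pi.sub_apply] at hi
    -- the unit steps `±e_i`
    have hsplit : ∀ z : Fin (d + 1) → ℤ, l1 z = (z i).natAbs + ∑ j ∈ univ.erase i, (z j).natAbs := by
      intro z; unfold l1; rw [← Finset.add_sum_erase _ _ (mem_univ i)]
    -- the first step of the staircase: move `y₁` one unit towards `y₂` in direction `i`
    have hbetween : ∀ (e : Fin (d + 1) → ℤ) (s : ℤ), e = Pi.single i s → (s = 1 ∨ s = -1) → (0 < s ↔ y₁ i < y₂ i) →
        P (y₁ + e) ∧ l1 (y₂ - (y₁ + e)) = n ∧ |g (y₁ + e) - g y₁| ≤ B := by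
      intro e s he hs hdir
      have hei : e i = s := by rw [he, Pi.single_eq_same]
      have hej : ∀ j, j ≠ i → e j = 0 := fun j hj => by rw [he, Pi.single_eq_of_ne hj]
      have hP1 : P (y₁ + e) := by
        refine hP y₁ y₂ hy₁ hy₂ _ fun j => ?_
        by_cases hj : j = i
        · subst hj
          rw [Pi.add_apply, hei]
          rcases hs with rfl | rfl
          · have : y₁ j < y₂ j := hdir.1 one_pos
            constructor
            · exact le_trans (min_le_left _ _) (by linarith)
            · exact le_trans (by linarith) (le_max_right _ _)
          · have : ¬ y₁ j < y₂ j := fun h => by have := hdir.2 h; linarith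
            have hlt : y₂ j < y₁ j := lt_of_le_of_ne (not_lt.1 this) (fun h => hi (by rw [h]; ring))
            constructor
            · exact le_trans (min_le_right _ _) (by linarith)
            · exact le_trans (by linarith) (le_max_left _ _)
        · rw [Pi.add_apply, hej j hj, add_zero]
          exact ⟨min_le_left _ _, le_max_left _ _⟩
      have hl1 : l1 (y₂ - (y₁ + e)) = n := by
        have e1 := hsplit (y₂ - y₁)
        have e2 := hsplit (y₂ - (y₁ + e))
        have hrest : ∑ j ∈ univ.erase i, ((y₂ - (y₁ + e)) j).natAbs = ∑ j ∈ univ.erase i, ((y₂ - y₁) j).natAbs := by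
          refine sum_congr rfl fun j hj => ?_
          have hji : j ≠ i := (mem_erase.1 hj).1
          simp only [Pi.sub_apply, Pi.add_apply, hej j hji, add_zero]
        have hii : ((y₂ - (y₁ + e)) i).natAbs + 1 = ((y₂ - y₁) i).natAbs := by
          simp only [Pi.sub_apply, Pi.add_apply, hei]
          rcases hs with rfl | rfl
          · have : y₁ i < y₂ i := hdir.1 one_pos
            omega
          · have : ¬ y₁ i < y₂ i := fun h => by have := hdir.2 h; linarith
            omega
        rw [e1] at hn
        rw [e2, hrest]
        omega
      have hg : |g (y₁ + e) - g y₁| ≤ B := by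
        rcases hs with rfl | rfl
        · rw [he]; exact hstep y₁ i hy₁ (he ▸ hP1)
        · have e0 : (y₁ + e) + Pi.single i 1 = y₁ := by
            rw [he, add_assoc, ← Pi.single_add]; simp
          have hP0 : P ((y₁ + e) + Pi.single i 1) := by rw [e0]; exact hy₁
          have h := hstep (y₁ + e) i hP1 hP0
          rw [e0] at h
          rwa [abs_sub_comm] at h
      exact ⟨hP1, hl1, hg⟩
    -- choose the direction of the step
    have hstep1 : ∃ e : Fin (d + 1) → ℤ, P (y₁ + e) ∧ l1 (y₂ - (y₁ + e)) = n ∧ |g (y₁ + e) - g y₁| ≤ B := by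
      by_cases hlt : y₁ i < y₂ i
      · exact ⟨Pi.single i 1, hbetween _ 1 rfl (Or.inl rfl) ⟨fun _ => hlt, fun _ => one_pos⟩⟩
      · exact ⟨Pi.single i (-1), hbetween _ (-1) rfl (Or.inr rfl)
          ⟨fun h => absurd h (by norm_num), fun h => absurd h hlt⟩⟩
    obtain ⟨e, hP1, hl1, hg1⟩ := hstep1
    have hrec := ih (y₁ + e) y₂ hl1 hP1 hy₂
    calc |g y₂ - g y₁| = |(g y₂ - g (y₁ + e)) + (g (y₁ + e) - g y₁)| := by ring_nf
      _ ≤ |g y₂ - g (y₁ + e)| + |g (y₁ + e) - g y₁| := abs_add_le _ _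
      _ ≤ B * n + B := add_le_add hrec hg1
      _ = B * ((n + 1 : ℕ) : ℝ) := by push_cast; ring

/-- kernel: the path lemma in the sup norm: `|g(y₂) − g(y₁)| ≤ B(d+1)|y₂ − y₁|_∞`. [folklore] -/
private theorem abs_sub_le_supNorm {P : (Fin (d + 1) → ℤ) → Prop} (hP : BoxConvex P) (g : (Fin (d + 1) → ℤ) → ℝ)
    {B : ℝ} (hB : 0 ≤ B) (hstep : ∀ (y : Fin (d + 1) → ℤ) (i : Fin (d + 1)), P y → P (y + Pi.single i 1) →
      |g (y + Pi.single i 1) - g y| ≤ B) {y₁ y₂ : Fin (d + 1) → ℤ} (hy₁ : P y₁) (hy₂ : P y₂) :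
    |g y₂ - g y₁| ≤ B * (((d : ℝ) + 1) * supNorm (y₂ - y₁)) := by
  have h := abs_sub_le_l1 hP g hstep (l1 (y₂ - y₁)) y₁ y₂ rfl hy₁ hy₂
  exact h.trans (mul_le_mul_of_nonneg_left (l1_le_supNorm _) hB)

/-- The fine sites of a cube `□(v′)` inside the box `□ = Π_i[0,N_i)` form a box-convex set. [folklore] -/
private theorem boxConvex_cube {b : ℕ} (hb : 1 ≤ b) (N : Fin (d + 1) → ℕ) (v : Fin (d + 1) → ℤ) :
    BoxConvex (fun y : Fin (d + 1) → ℤ => y ∈ boxDom N ∧ blk b y = v) := by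
  intro y₁ y₂ h1 h2 y hy
  have hb0 : (0 : ℤ) < b := by exact_mod_cast hb
  rw [mem_boxDom] at h1 h2 ⊢
  refine ⟨fun i => ?_, funext fun i => ?_⟩
  · obtain ⟨lo, hi⟩ := hy i
    constructor
    · exact le_trans (le_min (h1.1 i).1 (h2.1 i).1) lo
    · exact lt_of_le_of_lt hi (max_lt (h1.1 i).2 (h2.1 i).2)
  · obtain ⟨lo, hi⟩ := hy i
    have e1 : y₁ i / (b : ℤ) = v i := congr_fun h1.2 i
    have e2 : y₂ i / (b : ℤ) = v i := congr_fun h2.2 i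
    show y i / (b : ℤ) = v i
    have hlo : min (y₁ i) (y₂ i) / (b : ℤ) = v i := by
      rcases min_choice (y₁ i) (y₂ i) with h | h <;> rw [h] <;> assumption
    have hhi : max (y₁ i) (y₂ i) / (b : ℤ) = v i := by
      rcases max_choice (y₁ i) (y₂ i) with h | h <;> rw [h] <;> assumption
    have a1 := Int.ediv_le_ediv hb0 lo
    have a2 := Int.ediv_le_ediv hb0 hi
    rw [hlo] at a1
    rw [hhi] at a2
    exact le_antisymm a2 a1


/-! ## §3 The two-variable field `(x,x′) ↦ G^η_k(□,0;x,x′)` on `□(v) × □(v′)`, its lattice derivatives in the `2(d+1)` directions of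
the product lattice, and the norm (1.32) "extended in a natural way to functions of many variables" -/

section Field

variable (ℓ k : ℕ) (M : Fin (d + 1) → ℕ) (a m2 : ℝ)

/-- The two-variable field of (3.1) for the instance: `F(x, x′) = G^η_k(□,0;x,x′) = η^{−(d+1)}G_k(□,0;x,x′)` (`η^{−1} = L^k`;
`G_k(□,0) = Gfine ℓ k M k a m2 = (boxOpR (L^k) a_k m² M)⁻¹`, the values-normalised kernel of the `A = 0` box lineage), as a
function on the PRODUCT lattice `□ × □` of fine sites; the localization `h ⊗ h′ = 1_{□(v)} ⊗ 1_{□(v′)}` of p. 420 («we localize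
simply by representing Ω₁ as a sum of unit cubes») enters through the domain `sites v v′` over which the norm is taken.
[cite: Balaban1983Higgs3, (3.1) p.432] -/
def kerF (z : ↥(boxDom (Nf ℓ k M)) × ↥(boxDom (Nf ℓ k M))) : ℝ :=
  ((((ℓ + 1) ^ k : ℕ)) : ℝ) ^ (d + 1) * Gfine ℓ k M k a m2 z.1 z.2

/-- The localization domain `□(v) × □(v′)`: pairs of fine sites with `⌊x/L^k⌋ = v`, `⌊x′/L^k⌋ = v′` (the unit cubes of the
`L^kη = 1`-lattice). [cite: Balaban1983Higgs3, (3.1) p.432] -/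
def sites (v v' : Fin (d + 1) → ℤ) : Finset (↥(boxDom (Nf ℓ k M)) × ↥(boxDom (Nf ℓ k M))) :=
  univ.filter fun z => blk ((ℓ + 1) ^ k) z.1.1 = v ∧ blk ((ℓ + 1) ^ k) z.2.1 = v'

/-- Lattice bonds of the product lattice inside `□(v) × □(v′)`, indexed as `(direction, base point, shifted site)`: a ROW bond
`inl (μ, (x,x′), x+e_μ)` (both `x, x+e_μ ∈ □(v)`) or a COLUMN bond `inr (ν, (x,x′), x′+e_ν)` (both `x′, x′+e_ν ∈ □(v′)`) — the
index set of the covariant derivatives `D^η_{B̃,μ}` of (1.32) for a function of the `2(d+1)` lattice variables (here `B̃ = 0`).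
[cite: Balaban1983Higgs3, (1.32) p.420] -/
def bonds (v v' : Fin (d + 1) → ℤ) :
    Finset ((Fin (d + 1) × ((↥(boxDom (Nf ℓ k M)) × ↥(boxDom (Nf ℓ k M))) × ↥(boxDom (Nf ℓ k M)))) ⊕
      (Fin (d + 1) × ((↥(boxDom (Nf ℓ k M)) × ↥(boxDom (Nf ℓ k M))) × ↥(boxDom (Nf ℓ k M))))) :=
  (univ.filter fun b => b.2.1 ∈ sites ℓ k M v v' ∧ b.2.2.1 = b.2.1.1.1 + Pi.single b.1 1 ∧
      blk ((ℓ + 1) ^ k) b.2.2.1 = v).disjSum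
  (univ.filter fun b => b.2.1 ∈ sites ℓ k M v v' ∧ b.2.2.1 = b.2.1.2.1 + Pi.single b.1 1 ∧
      blk ((ℓ + 1) ^ k) b.2.2.1 = v')

/-- The lattice derivatives `∂^η F` of the two-variable field along the product-lattice bonds: `η^{−1}(F(x+e_μ,x′) − F(x,x′))` on a
row bond, `η^{−1}(F(x,x′+e_ν) − F(x,x′))` on a column bond (`U ≡ 1` at `B̃ = 0`). [cite: Balaban1983Higgs3, (1.32) p.420] -/
def derivF : ((Fin (d + 1) × ((↥(boxDom (Nf ℓ k M)) × ↥(boxDom (Nf ℓ k M))) × ↥(boxDom (Nf ℓ k M)))) ⊕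
      (Fin (d + 1) × ((↥(boxDom (Nf ℓ k M)) × ↥(boxDom (Nf ℓ k M))) × ↥(boxDom (Nf ℓ k M))))) → ℝ :=
  Sum.elim (fun b => (((ℓ + 1) ^ k : ℕ) : ℝ) * (kerF ℓ k M a m2 (b.2.2, b.2.1.2) - kerF ℓ k M a m2 b.2.1))
    (fun b => (((ℓ + 1) ^ k : ℕ) : ℝ) * (kerF ℓ k M a m2 (b.2.1.1, b.2.2) - kerF ℓ k M a m2 b.2.1))

/-- The direction of a bond (one of the `2(d+1)` directions of the product lattice). [cite: Balaban1983Higgs3, (1.32) p.420] -/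
def dirOf : ((Fin (d + 1) × ((↥(boxDom (Nf ℓ k M)) × ↥(boxDom (Nf ℓ k M))) × ↥(boxDom (Nf ℓ k M)))) ⊕
      (Fin (d + 1) × ((↥(boxDom (Nf ℓ k M)) × ↥(boxDom (Nf ℓ k M))) × ↥(boxDom (Nf ℓ k M))))) → Fin (d + 1) ⊕ Fin (d + 1) :=
  Sum.elim (fun b => Sum.inl b.1) (fun b => Sum.inr b.1)

/-- The base point `(x, x′)` of a bond. [cite: Balaban1983Higgs3, (1.32) p.420] -/
def baseOf : ((Fin (d + 1) × ((↥(boxDom (Nf ℓ k M)) × ↥(boxDom (Nf ℓ k M))) × ↥(boxDom (Nf ℓ k M)))) ⊕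
      (Fin (d + 1) × ((↥(boxDom (Nf ℓ k M)) × ↥(boxDom (Nf ℓ k M))) × ↥(boxDom (Nf ℓ k M))))) →
      ↥(boxDom (Nf ℓ k M)) × ↥(boxDom (Nf ℓ k M)) :=
  Sum.elim (fun b => b.2.1) (fun b => b.2.1)

/-- The sup-distance `|z − z′|` of two points of the product lattice in `η`-units: `η·max(|x − y|_∞, |x′ − y′|_∞)`.
[cite: Balaban1983Higgs3, (1.32) p.420] -/
def pdist (z z' : ↥(boxDom (Nf ℓ k M)) × ↥(boxDom (Nf ℓ k M))) : ℝ :=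
  max (supNorm (z.1.1 - z'.1.1)) (supNorm (z.2.1 - z'.2.1)) / (((ℓ + 1) ^ k : ℕ) : ℝ)

/-- **‖hG_k(□,0)h′‖_{1,α} for the instance**: the printed (1.32) SUM form `B3Sect1Statements.norm132` — `sup|F| + sup|∂F| +
sup |∂F(b′) − ∂F(b)|/|z(b) − z(b′)|^α` over same-direction bond pairs — of the two-variable field `F = G^η_k(□,0;·,·)` on the
localization domain `□(v) × □(v′)`, derivatives in all `2(d+1)` directions, transport `U(B̃(Γ)) = id` (`B̃ = 0`).  This is the
reading of «This definition extends in a natural way to functions of many variables» (p. 420) used here.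
[cite: Balaban1983Higgs3, (3.1) p.432] -/
def normHGH (α : ℝ) (v v' : Fin (d + 1) → ℤ) : ℝ :=
  norm132 α (fun c c' => dirOf ℓ k M c = dirOf ℓ k M c') (fun c c' => pdist ℓ k M (baseOf ℓ k M c) (baseOf ℓ k M c'))
    (fun _ _ => id) (sites ℓ k M v v') (bonds ℓ k M v v') (kerF ℓ k M a m2) (derivF ℓ k M a m2)

/-- **The concrete carrier of B3 §3 for the MODEL INSTANCE `A = B̃ = 0`, `Ω = □`** with the (3.1) fields modelled: localization
functions `LocFn` = the unit cubes `□(v)` of p. 420 (labelled by their integer corners `v ∈ ℤ^{d+1}` in `L^kη = 1` units; the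
propagator's localizing functions `h, h′` are the indicators of two such cubes), `distCubes = dist(□(v),□(v′))` (sup-distance of
the closed unit cubes, `cubeDist`), `normHGH α h h′ = ‖hG_k(□,0)h′‖_{1,α}` (`normHGH` above); the data of (3.2)–(3.5) (classes of
renormalized graphs, external fields, the expressions `E′`, `E3`, …) are NOT modelled: `RenClass′ = ∅` (so `Ineq32`, `Ineq33`,
`Claim35` are vacuous for this carrier and nothing is claimed about them), `e(L^kε) = λ(L^kε) = 0`.
[cite: Balaban1983Higgs3, (3.1) p.432] -/
def sect3ZeroBox : Sect3Data where
  eRun := 0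
  lamRun := 0
  LocFn := Fin (d + 1) → ℤ
  distCubes := cubeDist
  normHGH := fun α v v' => normHGH ℓ k M a m2 α v v'
  RenClass' := PEmpty
  Loc := fun G => G.elim
  ExtS := PUnit
  ExtV := PUnit
  E' := fun G => G.elim
  E3 := fun G => G.elim
  dv := fun G => G.elim
  ds := fun G => G.elim
  normS := fun _ _ => 0
  normV := fun _ _ => 0
  lhs35 := fun G => G.elim
  GenFamily := fun G => G.elim
  rhs35 := fun G => G.elim
  PosAlongOrderings := fun G => G.elim

/-- `(3.1)` for the carrier unfolds to the bound on `normHGH`. [cite: Balaban1983Higgs3, (3.1) p.432] -/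
theorem ineq31_iff (α δ₀ C : ℝ) :
    (sect3ZeroBox ℓ k M a m2).Ineq31 α δ₀ C ↔
      ∀ v v' : Fin (d + 1) → ℤ, 1 ≤ cubeDist v v' →
        normHGH ℓ k M a m2 α v v' ≤ C * Real.exp (-(δ₀ * cubeDist v v')) := Iff.rfl

end Field

/-! ## §4 The three parts of (1.32) for the instance, from the kernel estimates of `B3GkZeroBoxSeparated` at separation `ρ = 1` -/

section Parts

variable {ℓ k : ℕ} {M : Fin (d + 1) → ℕ} {a m2 : ℝ}

/-- kernel: points of the two cubes are separated: `L^k ≤ L^k·dist(□(v),□(v′)) ≤ |x − x′|_∞` when `dist(□(v),□(v′)) ≥ 1`.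
[cite: Balaban1983Higgs3, (3.1) p.432] -/
theorem sep_of_blk {x x' v v' : Fin (d + 1) → ℤ} (hx : blk ((ℓ + 1) ^ k) x = v) (hx' : blk ((ℓ + 1) ^ k) x' = v')
    (hD : 1 ≤ cubeDist v v') :
    1 * ((((ℓ + 1) ^ k : ℕ)) : ℝ) ≤ supNorm (x - x') ∧ cubeDist v v' ≤ supNorm (x - x') / ((((ℓ + 1) ^ k : ℕ)) : ℝ) := by
  have hL : (0 : ℝ) < ((((ℓ + 1) ^ k : ℕ)) : ℝ) := by positivity
  have h := cubeDist_mul_le_supNorm (Nat.one_le_pow _ _ (by omega)) hx hx'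
  push_cast at h ⊢
  have hL' : (0 : ℝ) < ((ℓ : ℝ) + 1) ^ k := by positivity
  refine ⟨?_, ?_⟩
  · calc 1 * ((ℓ : ℝ) + 1) ^ k = ((ℓ : ℝ) + 1) ^ k * 1 := by ring
      _ ≤ ((ℓ : ℝ) + 1) ^ k * cubeDist v v' := mul_le_mul_of_nonneg_left hD hL'.le
      _ ≤ supNorm (x - x') := h
  · rw [le_div_iff₀ (by positivity)]
    linarith

/-- kernel: the exponential at the actual distance is at most the exponential at the cube distance. [folklore] -/
private theorem exp_sep_le {δ n L D : ℝ} (hδ : 0 ≤ δ) (h : D ≤ n / L) :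
    Real.exp (-(δ * (n / L))) ≤ Real.exp (-(δ * D)) :=
  Real.exp_le_exp.2 (by nlinarith)

/-- kernel: unweighting a Hölder-weighted bound: `(L/s)^α·T ≤ K` gives `T ≤ K·(s/L)^α`. [folklore] -/
private theorem le_of_weight_mul_le {L s α T K : ℝ} (hL : 0 < L) (hs : 0 < s) (h : (L / s) ^ α * T ≤ K) :
    T ≤ K * (s / L) ^ α := by
  have hw : 0 < (L / s) ^ α := Real.rpow_pos_of_pos (div_pos hL hs) α
  have hinv : (s / L) ^ α = ((L / s) ^ α)⁻¹ := by
    rw [← Real.inv_rpow (div_pos hL hs).le, inv_div]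
  rw [hinv, ← div_eq_mul_inv, le_div_iff₀ hw, mul_comm]
  exact h

/-- **Part 1 of (1.32): `sup_{□(v)×□(v′)} |G^η_k(□,0;x,x′)| ≤ C_V·e^{−δ·dist(□(v),□(v′))}`** from the value clause at separation 1.
[cite: Balaban1983Higgs3, (3.1) p.432] -/
theorem supPart_le {δ CV : ℝ} (hδ : 0 ≤ δ) (hCV : 0 ≤ CV)
    (hV : ∀ x x' : ↥(boxDom (Nf ℓ k M)), 1 * ((((ℓ + 1) ^ k : ℕ)) : ℝ) ≤ supNorm (x.1 - x'.1) →
      ((((ℓ + 1) ^ k : ℕ)) : ℝ) ^ (d + 1) * |Gfine ℓ k M k a m2 x x'|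
        ≤ CV * Real.exp (-(δ * (supNorm (x.1 - x'.1) / ((((ℓ + 1) ^ k : ℕ)) : ℝ)))))
    {v v' : Fin (d + 1) → ℤ} (hD : 1 ≤ cubeDist v v') :
    LatticeNorms.supNorm (sites ℓ k M v v') (kerF ℓ k M a m2) ≤ CV * Real.exp (-(δ * cubeDist v v')) := by
  refine LatticeNorms.supNorm_le (by positivity) fun z hz => ?_
  obtain ⟨hz1, hz2⟩ := (mem_filter.1 hz).2
  obtain ⟨hsep, hDle⟩ := sep_of_blk hz1 hz2 hD
  have hL : (0 : ℝ) ≤ ((((ℓ + 1) ^ k : ℕ)) : ℝ) ^ (d + 1) := by positivity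
  rw [Real.norm_eq_abs, kerF, abs_mul, abs_of_nonneg hL]
  exact (hV z.1 z.2 hsep).trans (mul_le_mul_of_nonneg_left (exp_sep_le hδ hDle) hCV)

/-- **Part 2 of (1.32): `sup_{bonds} |∂^ηF| ≤ (C_D + C_D′)·e^{−δ·dist(□(v),□(v′))}`** from the row/column derivative clauses.
[cite: Balaban1983Higgs3, (3.1) p.432] -/
theorem derivPart_le {δ CD CD' : ℝ} (hδ : 0 ≤ δ) (hCD : 0 ≤ CD) (hCD' : 0 ≤ CD')
    (hDf : ∀ (μ : Fin (d + 1)) (x xe : ↥(boxDom (Nf ℓ k M))), xe.1 = x.1 + Pi.single μ 1 →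
      ∀ (x' : ↥(boxDom (Nf ℓ k M))), 1 * ((((ℓ + 1) ^ k : ℕ)) : ℝ) ≤ supNorm (x.1 - x'.1) →
        ((((ℓ + 1) ^ k : ℕ)) : ℝ) ^ (d + 1) *
            (((((ℓ + 1) ^ k : ℕ)) : ℝ) * |Gfine ℓ k M k a m2 xe x' - Gfine ℓ k M k a m2 x x'|)
          ≤ CD * Real.exp (-(δ * (supNorm (x.1 - x'.1) / ((((ℓ + 1) ^ k : ℕ)) : ℝ)))))
    (hDf' : ∀ (x : ↥(boxDom (Nf ℓ k M))) (ν : Fin (d + 1)) (x' xe' : ↥(boxDom (Nf ℓ k M))),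
      xe'.1 = x'.1 + Pi.single ν 1 → 1 * ((((ℓ + 1) ^ k : ℕ)) : ℝ) ≤ supNorm (x.1 - x'.1) →
        ((((ℓ + 1) ^ k : ℕ)) : ℝ) ^ (d + 1) *
            (((((ℓ + 1) ^ k : ℕ)) : ℝ) * |Gfine ℓ k M k a m2 x xe' - Gfine ℓ k M k a m2 x x'|)
          ≤ CD' * Real.exp (-(δ * (supNorm (x.1 - x'.1) / ((((ℓ + 1) ^ k : ℕ)) : ℝ)))))
    {v v' : Fin (d + 1) → ℤ} (hD : 1 ≤ cubeDist v v') :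
    LatticeNorms.supNorm (bonds ℓ k M v v') (derivF ℓ k M a m2) ≤ (CD + CD') * Real.exp (-(δ * cubeDist v v')) := by
  have hL : (0 : ℝ) ≤ ((((ℓ + 1) ^ k : ℕ)) : ℝ) := by positivity
  have hLp : (0 : ℝ) ≤ ((((ℓ + 1) ^ k : ℕ)) : ℝ) ^ (d + 1) := by positivity
  have hE : 0 ≤ Real.exp (-(δ * cubeDist v v')) := (Real.exp_pos _).le
  refine LatticeNorms.supNorm_le (by positivity) fun c hc => ?_
  rcases c with b | b
  · -- a row bond `(μ, (x,x′), x+e_μ)`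
    obtain ⟨hz, hxe, -⟩ := (mem_filter.1 (Finset.inl_mem_disjSum.1 hc)).2
    obtain ⟨hz1, hz2⟩ := (mem_filter.1 hz).2
    obtain ⟨hsep, hDle⟩ := sep_of_blk hz1 hz2 hD
    have h := hDf b.1 b.2.1.1 b.2.2 hxe b.2.1.2 hsep
    rw [Real.norm_eq_abs, derivF, Sum.elim_inl, kerF, kerF]
    rw [show (((ℓ + 1) ^ k : ℕ) : ℝ) * ((((ℓ + 1) ^ k : ℕ) : ℝ) ^ (d + 1) * Gfine ℓ k M k a m2 b.2.2 b.2.1.2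
          - (((ℓ + 1) ^ k : ℕ) : ℝ) ^ (d + 1) * Gfine ℓ k M k a m2 b.2.1.1 b.2.1.2)
        = (((ℓ + 1) ^ k : ℕ) : ℝ) ^ (d + 1) * ((((ℓ + 1) ^ k : ℕ) : ℝ) *
          (Gfine ℓ k M k a m2 b.2.2 b.2.1.2 - Gfine ℓ k M k a m2 b.2.1.1 b.2.1.2)) from by ring,
      abs_mul, abs_of_nonneg hLp, abs_mul, abs_of_nonneg hL]
    calc _ ≤ CD * Real.exp (-(δ * (supNorm (b.2.1.1.1 - b.2.1.2.1) / ((((ℓ + 1) ^ k : ℕ)) : ℝ)))) := h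
      _ ≤ CD * Real.exp (-(δ * cubeDist v v')) := mul_le_mul_of_nonneg_left (exp_sep_le hδ hDle) hCD
      _ ≤ (CD + CD') * Real.exp (-(δ * cubeDist v v')) := by nlinarith
  · -- a column bond `(ν, (x,x′), x′+e_ν)`
    obtain ⟨hz, hxe, -⟩ := (mem_filter.1 (Finset.inr_mem_disjSum.1 hc)).2
    obtain ⟨hz1, hz2⟩ := (mem_filter.1 hz).2
    obtain ⟨hsep, hDle⟩ := sep_of_blk hz1 hz2 hD
    have h := hDf' b.2.1.1 b.1 b.2.1.2 b.2.2 hxe hsep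
    rw [Real.norm_eq_abs, derivF, Sum.elim_inr, kerF, kerF]
    rw [show (((ℓ + 1) ^ k : ℕ) : ℝ) * ((((ℓ + 1) ^ k : ℕ) : ℝ) ^ (d + 1) * Gfine ℓ k M k a m2 b.2.1.1 b.2.2
          - (((ℓ + 1) ^ k : ℕ) : ℝ) ^ (d + 1) * Gfine ℓ k M k a m2 b.2.1.1 b.2.1.2)
        = (((ℓ + 1) ^ k : ℕ) : ℝ) ^ (d + 1) * ((((ℓ + 1) ^ k : ℕ) : ℝ) *
          (Gfine ℓ k M k a m2 b.2.1.1 b.2.2 - Gfine ℓ k M k a m2 b.2.1.1 b.2.1.2)) from by ring,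
      abs_mul, abs_of_nonneg hLp, abs_mul, abs_of_nonneg hL]
    calc _ ≤ CD' * Real.exp (-(δ * (supNorm (b.2.1.1.1 - b.2.1.2.1) / ((((ℓ + 1) ^ k : ℕ)) : ℝ)))) := h
      _ ≤ CD' * Real.exp (-(δ * cubeDist v v')) := mul_le_mul_of_nonneg_left (exp_sep_le hδ hDle) hCD'
      _ ≤ (CD + CD') * Real.exp (-(δ * cubeDist v v')) := by nlinarith


/-- kernel: `t ≤ t^α` for `0 < t ≤ 1`, `α ≤ 1`; `1 ≤ t^α` for `1 ≤ t`, `0 ≤ α`: in both regimes `min(t, 1) ≤ t^α`-type bounds used to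
trade a linear or a constant bound for the Hölder power. [folklore] -/
private theorem le_rpow_of_le_one {t α : ℝ} (ht0 : 0 < t) (ht1 : t ≤ 1) (hα1 : α ≤ 1) : t ≤ t ^ α := by
  calc t = t ^ (1 : ℝ) := (Real.rpow_one t).symm
    _ ≤ t ^ α := Real.rpow_le_rpow_of_exponent_ge ht0 ht1 hα1

set_option maxHeartbeats 1600000 in
/-- **Part 3 of (1.32): the Hölder quotients of the derivatives of `F = G^η_k(□,0;·,·)` over same-direction bond pairs of
`□(v) × □(v′)` are `≤ C·e^{−δ·dist(□(v),□(v′))}·|z − z′|^α`.**  For two ROW bonds `(μ,(x₁,x₁′))`, `(μ,(x₂,x₂′))` the difference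
`∂_μF(x₂,x₂′) − ∂_μF(x₁,x₁′)` is split at `(x₁,x₂′)`: the first half is the Hölder quotient of the row derivative in the row
variable (kernel clause `abs_GkDD_sep_le`, weight `(L^k/|x₂−x₁|)^α` removed), the second half is a variation in the COLUMN variable,
telescoped along a staircase path inside `□(v′)` with steps bounded by the mixed clause (`abs_GkMixed_sep_le`) when
`η|x₂′−x₁′| ≤ 1` (then `t ≤ t^α`), and bounded by twice the derivative sup (`abs_GkDiff_sep_le`) when `η|x₂′−x₁′| > 1` (then
`1 ≤ t^α`); column bonds symmetrically. [cite: Balaban1983Higgs3, (3.1) p.432] -/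
theorem holderPart_le {α δ CD CD' CH CH' CM : ℝ} (hα0 : 0 ≤ α) (hα1 : α < 1) (hδ : 0 ≤ δ) (hCD : 0 ≤ CD)
    (hCD' : 0 ≤ CD') (hCH : 0 ≤ CH) (hCH' : 0 ≤ CH') (hCM : 0 ≤ CM)
    (hDf : ∀ (μ : Fin (d + 1)) (x xe : ↥(boxDom (Nf ℓ k M))), xe.1 = x.1 + Pi.single μ 1 →
      ∀ (x' : ↥(boxDom (Nf ℓ k M))), 1 * ((((ℓ + 1) ^ k : ℕ)) : ℝ) ≤ supNorm (x.1 - x'.1) →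
        ((((ℓ + 1) ^ k : ℕ)) : ℝ) ^ (d + 1) *
            (((((ℓ + 1) ^ k : ℕ)) : ℝ) * |Gfine ℓ k M k a m2 xe x' - Gfine ℓ k M k a m2 x x'|)
          ≤ CD * Real.exp (-(δ * (supNorm (x.1 - x'.1) / ((((ℓ + 1) ^ k : ℕ)) : ℝ)))))
    (hDf' : ∀ (x : ↥(boxDom (Nf ℓ k M))) (ν : Fin (d + 1)) (x' xe' : ↥(boxDom (Nf ℓ k M))),
      xe'.1 = x'.1 + Pi.single ν 1 → 1 * ((((ℓ + 1) ^ k : ℕ)) : ℝ) ≤ supNorm (x.1 - x'.1) →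
        ((((ℓ + 1) ^ k : ℕ)) : ℝ) ^ (d + 1) *
            (((((ℓ + 1) ^ k : ℕ)) : ℝ) * |Gfine ℓ k M k a m2 x xe' - Gfine ℓ k M k a m2 x x'|)
          ≤ CD' * Real.exp (-(δ * (supNorm (x.1 - x'.1) / ((((ℓ + 1) ^ k : ℕ)) : ℝ)))))
    (hH : ∀ (μ : Fin (d + 1)) (x₁ xe₁ x₂ xe₂ : ↥(boxDom (Nf ℓ k M))), xe₁.1 = x₁.1 + Pi.single μ 1 →
      xe₂.1 = x₂.1 + Pi.single μ 1 → x₂.1 ≠ x₁.1 → ∀ (x : ↥(boxDom (Nf ℓ k M))),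
      1 * ((((ℓ + 1) ^ k : ℕ)) : ℝ) ≤ min (supNorm (x₁.1 - x.1)) (supNorm (x₂.1 - x.1)) →
        ((((ℓ + 1) ^ k : ℕ) : ℝ) / supNorm (x₂.1 - x₁.1)) ^ α *
            (((((ℓ + 1) ^ k : ℕ)) : ℝ) ^ (d + 1) *
              ((((ℓ + 1) ^ k : ℕ) : ℝ) * |(Gfine ℓ k M k a m2 xe₂ x - Gfine ℓ k M k a m2 x₂ x)
                - (Gfine ℓ k M k a m2 xe₁ x - Gfine ℓ k M k a m2 x₁ x)|))
          ≤ CH * Real.exp (-(δ * (min (supNorm (x₁.1 - x.1)) (supNorm (x₂.1 - x.1)) / ((((ℓ + 1) ^ k : ℕ)) : ℝ)))))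
    (hH' : ∀ (x : ↥(boxDom (Nf ℓ k M))) (ν : Fin (d + 1)) (x₁' xe₁' x₂' xe₂' : ↥(boxDom (Nf ℓ k M))),
      xe₁'.1 = x₁'.1 + Pi.single ν 1 → xe₂'.1 = x₂'.1 + Pi.single ν 1 → x₂'.1 ≠ x₁'.1 →
      1 * ((((ℓ + 1) ^ k : ℕ)) : ℝ) ≤ min (supNorm (x.1 - x₁'.1)) (supNorm (x.1 - x₂'.1)) →
        ((((ℓ + 1) ^ k : ℕ) : ℝ) / supNorm (x₂'.1 - x₁'.1)) ^ α *
            (((((ℓ + 1) ^ k : ℕ)) : ℝ) ^ (d + 1) *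
              ((((ℓ + 1) ^ k : ℕ) : ℝ) * |(Gfine ℓ k M k a m2 x xe₂' - Gfine ℓ k M k a m2 x x₂')
                - (Gfine ℓ k M k a m2 x xe₁' - Gfine ℓ k M k a m2 x x₁')|))
          ≤ CH' * Real.exp (-(δ * (min (supNorm (x.1 - x₁'.1)) (supNorm (x.1 - x₂'.1)) / ((((ℓ + 1) ^ k : ℕ)) : ℝ)))))
    (hMx : ∀ (μ ν : Fin (d + 1)) (x xe : ↥(boxDom (Nf ℓ k M))), xe.1 = x.1 + Pi.single μ 1 →
      ∀ (x' xe' : ↥(boxDom (Nf ℓ k M))), xe'.1 = x'.1 + Pi.single ν 1 →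
      1 * ((((ℓ + 1) ^ k : ℕ)) : ℝ) ≤ supNorm (x.1 - x'.1) →
        ((((ℓ + 1) ^ k : ℕ)) : ℝ) ^ (d + 1) *
            (((((ℓ + 1) ^ k : ℕ)) : ℝ) ^ 2 * |(Gfine ℓ k M k a m2 xe xe' - Gfine ℓ k M k a m2 x xe')
              - (Gfine ℓ k M k a m2 xe x' - Gfine ℓ k M k a m2 x x')|)
          ≤ CM * Real.exp (-(δ * (supNorm (x.1 - x'.1) / ((((ℓ + 1) ^ k : ℕ)) : ℝ)))))
    {v v' : Fin (d + 1) → ℤ} (hD : 1 ≤ cubeDist v v') :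
    LatticeNorms.holderSeminorm α (fun c c' => dirOf ℓ k M c = dirOf ℓ k M c')
        (fun c c' => pdist ℓ k M (baseOf ℓ k M c) (baseOf ℓ k M c')) (fun _ _ => id) (bonds ℓ k M v v')
        (derivF ℓ k M a m2)
      ≤ ((CH + ((d : ℝ) + 1) * CM + 2 * CD) + (CH' + ((d : ℝ) + 1) * CM + 2 * CD'))
          * Real.exp (-(δ * cubeDist v v')) := by
  set L : ℝ := ((((ℓ + 1) ^ k : ℕ)) : ℝ) with hLdef
  have hL : 0 < L := by rw [hLdef]; positivity
  have hLp : 0 < L ^ (d + 1) := pow_pos hL _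
  set E : ℝ := Real.exp (-(δ * cubeDist v v')) with hEdef
  have hE : 0 < E := Real.exp_pos _
  have hb : 1 ≤ (ℓ + 1) ^ k := Nat.one_le_pow _ _ (by omega)
  have hd1 : (0 : ℝ) ≤ (d : ℝ) + 1 := by positivity
  have hK1 : 0 ≤ CH + ((d : ℝ) + 1) * CM + 2 * CD := by positivity
  have hK2 : 0 ≤ CH' + ((d : ℝ) + 1) * CM + 2 * CD' := by positivity
  -- the factorised form of a derivative value
  have hfac : ∀ (p q r s : ↥(boxDom (Nf ℓ k M))),
      L * (L ^ (d + 1) * Gfine ℓ k M k a m2 p q - L ^ (d + 1) * Gfine ℓ k M k a m2 r s)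
        = L ^ (d + 1) * (L * (Gfine ℓ k M k a m2 p q - Gfine ℓ k M k a m2 r s)) := by
    intro p q r s; ring
  refine LatticeNorms.holderSeminorm_le (by positivity) fun c hc c' hc' hdir hpos => ?_
  rw [Real.norm_eq_abs]
  change |derivF ℓ k M a m2 c' - derivF ℓ k M a m2 c|
    ≤ ((CH + ((d : ℝ) + 1) * CM + 2 * CD) + (CH' + ((d : ℝ) + 1) * CM + 2 * CD')) * E
      * (pdist ℓ k M (baseOf ℓ k M c) (baseOf ℓ k M c')) ^ α
  rcases c with b₁ | b₁ <;> rcases c' with b₂ | b₂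
  · ----------------------------------------------------------------- two ROW bonds
    simp only [dirOf, Sum.elim_inl, Sum.inl.injEq] at hdir
    obtain ⟨hz₁, hxe₁, hbe₁⟩ := (mem_filter.1 (Finset.inl_mem_disjSum.1 hc)).2
    obtain ⟨hz₂, hxe₂, hbe₂⟩ := (mem_filter.1 (Finset.inl_mem_disjSum.1 hc')).2
    obtain ⟨hx₁, hx₁'⟩ := (mem_filter.1 hz₁).2
    obtain ⟨hx₂, hx₂'⟩ := (mem_filter.1 hz₂).2
    -- names
    obtain ⟨μ₁, ⟨x₁, x₁'⟩, xe₁⟩ := b₁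
    obtain ⟨μ₂, ⟨x₂, x₂'⟩, xe₂⟩ := b₂
    simp only at hdir hxe₁ hxe₂ hbe₁ hbe₂ hx₁ hx₁' hx₂ hx₂' ⊢
    subst hdir
    simp only [baseOf, Sum.elim_inl, derivF, kerF, pdist]
    rw [hfac, hfac]
    set P : ℝ := max (supNorm (x₁.1 - x₂.1)) (supNorm (x₁'.1 - x₂'.1)) / L with hPdef
    have hP0 : 0 ≤ P := div_nonneg (le_trans (supNorm_nonneg _) (le_max_left _ _)) hL.le
    -- separations
    have s12' := sep_of_blk (ℓ := ℓ) (k := k) hx₁ hx₂' hD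
    have s22' := sep_of_blk (ℓ := ℓ) (k := k) hx₂ hx₂' hD
    have s11' := sep_of_blk (ℓ := ℓ) (k := k) hx₁ hx₁' hD
    -- T1: same column `x₂′`, rows `x₁ → x₂`
    have T1 : |L ^ (d + 1) * (L * (Gfine ℓ k M k a m2 xe₂ x₂' - Gfine ℓ k M k a m2 x₂ x₂'))
          - L ^ (d + 1) * (L * (Gfine ℓ k M k a m2 xe₁ x₂' - Gfine ℓ k M k a m2 x₁ x₂'))|
        ≤ CH * E * P ^ α := by
      by_cases hx : x₂.1 = x₁.1
      · have hxe : xe₂ = xe₁ := Subtype.ext (by rw [hxe₂, hxe₁, hx])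
        have hxx : x₂ = x₁ := Subtype.ext hx
        rw [hxe, hxx, sub_self, abs_zero]; positivity
      · have hs0 : 0 < supNorm (x₂.1 - x₁.1) :=
          lt_of_lt_of_le one_pos (B4StripSumsHolder.one_le_supNorm (sub_ne_zero.2 hx))
        have h := hH μ₁ x₁ xe₁ x₂ xe₂ hxe₁ hxe₂ hx x₂' (le_min s12'.1 s22'.1)
        have hmin : cubeDist v v' ≤ min (supNorm (x₁.1 - x₂'.1)) (supNorm (x₂.1 - x₂'.1)) / L := by
          rw [le_div_iff₀ hL]
          have a1 := s12'.2; have a2 := s22'.2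
          rw [le_div_iff₀ hL] at a1 a2
          exact le_min a1 a2
        have h2 := h.trans (mul_le_mul_of_nonneg_left (exp_sep_le hδ hmin) hCH)
        rw [← mul_sub, ← mul_sub, abs_mul, abs_mul, abs_of_pos hLp, abs_of_pos hL]
        have h3 := le_of_weight_mul_le hL hs0 h2
        refine h3.trans (mul_le_mul_of_nonneg_left ?_ (by positivity))
        refine Real.rpow_le_rpow (div_nonneg hs0.le hL.le) ?_ hα0
        rw [hPdef]
        refine div_le_div_of_nonneg_right ?_ hL.le
        rw [show supNorm (x₂.1 - x₁.1) = supNorm (x₁.1 - x₂.1) from by rw [← B4TorusKernel.supNorm_neg, neg_sub]]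
        exact le_max_left _ _
    -- T2: same row bond `(x₁, xe₁)`, columns `x₁′ → x₂′`
    have T2 : |L ^ (d + 1) * (L * (Gfine ℓ k M k a m2 xe₁ x₂' - Gfine ℓ k M k a m2 x₁ x₂'))
          - L ^ (d + 1) * (L * (Gfine ℓ k M k a m2 xe₁ x₁' - Gfine ℓ k M k a m2 x₁ x₁'))|
        ≤ (((d : ℝ) + 1) * CM + 2 * CD) * E * P ^ α := by
      by_cases hx' : x₂'.1 = x₁'.1
      · have hxx : x₂' = x₁' := Subtype.ext hx'
        rw [hxx, sub_self, abs_zero]; positivity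
      · have hs1 : 1 ≤ supNorm (x₂'.1 - x₁'.1) := B4StripSumsHolder.one_le_supNorm (sub_ne_zero.2 hx')
        set t : ℝ := supNorm (x₂'.1 - x₁'.1) / L with htdef
        have ht0 : 0 < t := div_pos (lt_of_lt_of_le one_pos hs1) hL
        have htP : t ≤ P := by
          rw [htdef, hPdef]
          refine div_le_div_of_nonneg_right ?_ hL.le
          rw [show supNorm (x₂'.1 - x₁'.1) = supNorm (x₁'.1 - x₂'.1) from by
            rw [← B4TorusKernel.supNorm_neg, neg_sub]]
          exact le_max_right _ _
        have htPα : t ^ α ≤ P ^ α := Real.rpow_le_rpow ht0.le htP hα0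
        by_cases ht1 : t ≤ 1
        · -- telescoping in the column variable inside `□(v′)`
          set g : (Fin (d + 1) → ℤ) → ℝ := fun y =>
            if h : y ∈ boxDom (Nf ℓ k M) then
              L ^ (d + 1) * (L * (Gfine ℓ k M k a m2 xe₁ ⟨y, h⟩ - Gfine ℓ k M k a m2 x₁ ⟨y, h⟩)) else 0 with hgdef
          have hgy : ∀ (y : Fin (d + 1) → ℤ) (hy : y ∈ boxDom (Nf ℓ k M)),
              g y = L ^ (d + 1) * (L * (Gfine ℓ k M k a m2 xe₁ ⟨y, hy⟩ - Gfine ℓ k M k a m2 x₁ ⟨y, hy⟩)) := by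
            intro y hy; simp only [hgdef, dif_pos hy]
          have hstep : ∀ (y : Fin (d + 1) → ℤ) (i : Fin (d + 1)),
              (y ∈ boxDom (Nf ℓ k M) ∧ blk ((ℓ + 1) ^ k) y = v') →
              ((y + Pi.single i 1) ∈ boxDom (Nf ℓ k M) ∧ blk ((ℓ + 1) ^ k) (y + Pi.single i 1) = v') →
              |g (y + Pi.single i 1) - g y| ≤ CM * E / L := by
            intro y i hy hye
            rw [hgy y hy.1, hgy _ hye.1]
            have hm := hMx μ₁ i x₁ xe₁ hxe₁ ⟨y, hy.1⟩ ⟨y + Pi.single i 1, hye.1⟩ rfl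
              (sep_of_blk (ℓ := ℓ) (k := k) hx₁ hy.2 hD).1
            have hm2 := hm.trans (mul_le_mul_of_nonneg_left
              (exp_sep_le hδ (sep_of_blk (ℓ := ℓ) (k := k) hx₁ hy.2 hD).2) hCM)
            rw [le_div_iff₀ hL]
            calc |L ^ (d + 1) * (L * (Gfine ℓ k M k a m2 xe₁ ⟨y + Pi.single i 1, hye.1⟩
                    - Gfine ℓ k M k a m2 x₁ ⟨y + Pi.single i 1, hye.1⟩))
                  - L ^ (d + 1) * (L * (Gfine ℓ k M k a m2 xe₁ ⟨y, hy.1⟩ - Gfine ℓ k M k a m2 x₁ ⟨y, hy.1⟩))| * L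
                = L ^ (d + 1) * (L ^ 2 * |(Gfine ℓ k M k a m2 xe₁ ⟨y + Pi.single i 1, hye.1⟩
                    - Gfine ℓ k M k a m2 x₁ ⟨y + Pi.single i 1, hye.1⟩)
                    - (Gfine ℓ k M k a m2 xe₁ ⟨y, hy.1⟩ - Gfine ℓ k M k a m2 x₁ ⟨y, hy.1⟩)|) := by
                  rw [← mul_sub, ← mul_sub, abs_mul, abs_mul, abs_of_pos hLp, abs_of_pos hL]; ring
              _ ≤ CM * E := hm2
          have hpath := abs_sub_le_supNorm (boxConvex_cube hb (Nf ℓ k M) v') g (by positivity) hstep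
            ⟨x₁'.2, hx₁'⟩ ⟨x₂'.2, hx₂'⟩
          rw [hgy _ x₁'.2, hgy _ x₂'.2] at hpath
          calc _ ≤ CM * E / L * (((d : ℝ) + 1) * supNorm (x₂'.1 - x₁'.1)) := hpath
            _ = ((d : ℝ) + 1) * CM * E * t := by rw [htdef]; field_simp
            _ ≤ ((d : ℝ) + 1) * CM * E * t ^ α :=
                mul_le_mul_of_nonneg_left (le_rpow_of_le_one ht0 ht1 hα1.le) (by positivity)
            _ ≤ (((d : ℝ) + 1) * CM + 2 * CD) * E * t ^ α := by
                have h01 : 0 ≤ 2 * CD * (E * t ^ α) := by positivity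
                have h02 : 0 ≤ ((d : ℝ) + 1) * CM * (E * t ^ α) := by positivity
                nlinarith
            _ ≤ (((d : ℝ) + 1) * CM + 2 * CD) * E * P ^ α := mul_le_mul_of_nonneg_left htPα (by positivity)
        · -- far apart in the column variable: twice the derivative sup
          push Not at ht1
          have h1 := (hDf μ₁ x₁ xe₁ hxe₁ x₂' s12'.1).trans
            (mul_le_mul_of_nonneg_left (exp_sep_le hδ s12'.2) hCD)
          have h2 := (hDf μ₁ x₁ xe₁ hxe₁ x₁' s11'.1).trans
            (mul_le_mul_of_nonneg_left (exp_sep_le hδ s11'.2) hCD)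
          have h1α : 1 ≤ t ^ α := Real.one_le_rpow ht1.le hα0
          calc _ ≤ |L ^ (d + 1) * (L * (Gfine ℓ k M k a m2 xe₁ x₂' - Gfine ℓ k M k a m2 x₁ x₂'))|
                + |L ^ (d + 1) * (L * (Gfine ℓ k M k a m2 xe₁ x₁' - Gfine ℓ k M k a m2 x₁ x₁'))| := abs_sub _ _
            _ = L ^ (d + 1) * (L * |Gfine ℓ k M k a m2 xe₁ x₂' - Gfine ℓ k M k a m2 x₁ x₂'|)
                + L ^ (d + 1) * (L * |Gfine ℓ k M k a m2 xe₁ x₁' - Gfine ℓ k M k a m2 x₁ x₁'|) := by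
                rw [abs_mul, abs_mul, abs_of_pos hLp, abs_of_pos hL, abs_mul, abs_mul, abs_of_pos hLp, abs_of_pos hL]
            _ ≤ CD * E + CD * E := add_le_add h1 h2
            _ = 2 * CD * E * 1 := by ring
            _ ≤ 2 * CD * E * t ^ α := mul_le_mul_of_nonneg_left h1α (by positivity)
            _ ≤ (((d : ℝ) + 1) * CM + 2 * CD) * E * t ^ α := by
                have h01 : 0 ≤ 2 * CD * (E * t ^ α) := by positivity
                have h02 : 0 ≤ ((d : ℝ) + 1) * CM * (E * t ^ α) := by positivity
                nlinarith
            _ ≤ (((d : ℝ) + 1) * CM + 2 * CD) * E * P ^ α := mul_le_mul_of_nonneg_left htPα (by positivity)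
    calc |L ^ (d + 1) * (L * (Gfine ℓ k M k a m2 xe₂ x₂' - Gfine ℓ k M k a m2 x₂ x₂'))
          - L ^ (d + 1) * (L * (Gfine ℓ k M k a m2 xe₁ x₁' - Gfine ℓ k M k a m2 x₁ x₁'))|
        ≤ |L ^ (d + 1) * (L * (Gfine ℓ k M k a m2 xe₂ x₂' - Gfine ℓ k M k a m2 x₂ x₂'))
            - L ^ (d + 1) * (L * (Gfine ℓ k M k a m2 xe₁ x₂' - Gfine ℓ k M k a m2 x₁ x₂'))|
          + |L ^ (d + 1) * (L * (Gfine ℓ k M k a m2 xe₁ x₂' - Gfine ℓ k M k a m2 x₁ x₂'))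
            - L ^ (d + 1) * (L * (Gfine ℓ k M k a m2 xe₁ x₁' - Gfine ℓ k M k a m2 x₁ x₁'))| := abs_sub_le _ _ _
      _ ≤ CH * E * P ^ α + (((d : ℝ) + 1) * CM + 2 * CD) * E * P ^ α := add_le_add T1 T2
      _ = (CH + ((d : ℝ) + 1) * CM + 2 * CD) * E * P ^ α := by ring
      _ ≤ _ := by
          have : 0 ≤ E * P ^ α := by positivity
          nlinarith
  · -- a row bond and a column bond never have the same direction
    simp [dirOf] at hdir
  · simp [dirOf] at hdir
  · ----------------------------------------------------------------- two COLUMN bonds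
    simp only [dirOf, Sum.elim_inr, Sum.inr.injEq] at hdir
    obtain ⟨hz₁, hxe₁, hbe₁⟩ := (mem_filter.1 (Finset.inr_mem_disjSum.1 hc)).2
    obtain ⟨hz₂, hxe₂, hbe₂⟩ := (mem_filter.1 (Finset.inr_mem_disjSum.1 hc')).2
    obtain ⟨hx₁, hx₁'⟩ := (mem_filter.1 hz₁).2
    obtain ⟨hx₂, hx₂'⟩ := (mem_filter.1 hz₂).2
    obtain ⟨ν₁, ⟨x₁, x₁'⟩, xe₁'⟩ := b₁
    obtain ⟨ν₂, ⟨x₂, x₂'⟩, xe₂'⟩ := b₂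
    simp only at hdir hxe₁ hxe₂ hbe₁ hbe₂ hx₁ hx₁' hx₂ hx₂' ⊢
    subst hdir
    simp only [baseOf, Sum.elim_inr, derivF, kerF, pdist]
    rw [hfac, hfac]
    set P : ℝ := max (supNorm (x₁.1 - x₂.1)) (supNorm (x₁'.1 - x₂'.1)) / L with hPdef
    have hP0 : 0 ≤ P := div_nonneg (le_trans (supNorm_nonneg _) (le_max_left _ _)) hL.le
    have s21' := sep_of_blk (ℓ := ℓ) (k := k) hx₂ hx₁' hD
    have s22' := sep_of_blk (ℓ := ℓ) (k := k) hx₂ hx₂' hD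
    have s11' := sep_of_blk (ℓ := ℓ) (k := k) hx₁ hx₁' hD
    -- T1′: same row `x₂`, column bonds `x₁′ → x₂′`
    have T1 : |L ^ (d + 1) * (L * (Gfine ℓ k M k a m2 x₂ xe₂' - Gfine ℓ k M k a m2 x₂ x₂'))
          - L ^ (d + 1) * (L * (Gfine ℓ k M k a m2 x₂ xe₁' - Gfine ℓ k M k a m2 x₂ x₁'))|
        ≤ CH' * E * P ^ α := by
      by_cases hx : x₂'.1 = x₁'.1
      · have hxe : xe₂' = xe₁' := Subtype.ext (by rw [hxe₂, hxe₁, hx])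
        have hxx : x₂' = x₁' := Subtype.ext hx
        rw [hxe, hxx, sub_self, abs_zero]; positivity
      · have hs0 : 0 < supNorm (x₂'.1 - x₁'.1) :=
          lt_of_lt_of_le one_pos (B4StripSumsHolder.one_le_supNorm (sub_ne_zero.2 hx))
        have h := hH' x₂ ν₁ x₁' xe₁' x₂' xe₂' hxe₁ hxe₂ hx (le_min s21'.1 s22'.1)
        have hmin : cubeDist v v' ≤ min (supNorm (x₂.1 - x₁'.1)) (supNorm (x₂.1 - x₂'.1)) / L := by
          rw [le_div_iff₀ hL]
          have a1 := s21'.2; have a2 := s22'.2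
          rw [le_div_iff₀ hL] at a1 a2
          exact le_min a1 a2
        have h2 := h.trans (mul_le_mul_of_nonneg_left (exp_sep_le hδ hmin) hCH')
        rw [← mul_sub, ← mul_sub, abs_mul, abs_mul, abs_of_pos hLp, abs_of_pos hL]
        have h3 := le_of_weight_mul_le hL hs0 h2
        refine h3.trans (mul_le_mul_of_nonneg_left ?_ (by positivity))
        refine Real.rpow_le_rpow (div_nonneg hs0.le hL.le) ?_ hα0
        rw [hPdef]
        refine div_le_div_of_nonneg_right ?_ hL.le
        rw [show supNorm (x₂'.1 - x₁'.1) = supNorm (x₁'.1 - x₂'.1) from by rw [← B4TorusKernel.supNorm_neg, neg_sub]]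
        exact le_max_right _ _
    -- T2′: same column bond `(x₁′, xe₁′)`, rows `x₁ → x₂`
    have T2 : |L ^ (d + 1) * (L * (Gfine ℓ k M k a m2 x₂ xe₁' - Gfine ℓ k M k a m2 x₂ x₁'))
          - L ^ (d + 1) * (L * (Gfine ℓ k M k a m2 x₁ xe₁' - Gfine ℓ k M k a m2 x₁ x₁'))|
        ≤ (((d : ℝ) + 1) * CM + 2 * CD') * E * P ^ α := by
      by_cases hx' : x₂.1 = x₁.1
      · have hxx : x₂ = x₁ := Subtype.ext hx'
        rw [hxx, sub_self, abs_zero]; positivity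
      · have hs1 : 1 ≤ supNorm (x₂.1 - x₁.1) := B4StripSumsHolder.one_le_supNorm (sub_ne_zero.2 hx')
        set t : ℝ := supNorm (x₂.1 - x₁.1) / L with htdef
        have ht0 : 0 < t := div_pos (lt_of_lt_of_le one_pos hs1) hL
        have htP : t ≤ P := by
          rw [htdef, hPdef]
          refine div_le_div_of_nonneg_right ?_ hL.le
          rw [show supNorm (x₂.1 - x₁.1) = supNorm (x₁.1 - x₂.1) from by
            rw [← B4TorusKernel.supNorm_neg, neg_sub]]
          exact le_max_left _ _
        have htPα : t ^ α ≤ P ^ α := Real.rpow_le_rpow ht0.le htP hα0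
        by_cases ht1 : t ≤ 1
        · -- telescoping in the row variable inside `□(v)`
          set g : (Fin (d + 1) → ℤ) → ℝ := fun y =>
            if h : y ∈ boxDom (Nf ℓ k M) then
              L ^ (d + 1) * (L * (Gfine ℓ k M k a m2 ⟨y, h⟩ xe₁' - Gfine ℓ k M k a m2 ⟨y, h⟩ x₁')) else 0 with hgdef
          have hgy : ∀ (y : Fin (d + 1) → ℤ) (hy : y ∈ boxDom (Nf ℓ k M)),
              g y = L ^ (d + 1) * (L * (Gfine ℓ k M k a m2 ⟨y, hy⟩ xe₁' - Gfine ℓ k M k a m2 ⟨y, hy⟩ x₁')) := by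
            intro y hy; simp only [hgdef, dif_pos hy]
          have hstep : ∀ (y : Fin (d + 1) → ℤ) (i : Fin (d + 1)),
              (y ∈ boxDom (Nf ℓ k M) ∧ blk ((ℓ + 1) ^ k) y = v) →
              ((y + Pi.single i 1) ∈ boxDom (Nf ℓ k M) ∧ blk ((ℓ + 1) ^ k) (y + Pi.single i 1) = v) →
              |g (y + Pi.single i 1) - g y| ≤ CM * E / L := by
            intro y i hy hye
            rw [hgy y hy.1, hgy _ hye.1]
            have hm := hMx i ν₁ ⟨y, hy.1⟩ ⟨y + Pi.single i 1, hye.1⟩ rfl x₁' xe₁' hxe₁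
              (sep_of_blk (ℓ := ℓ) (k := k) hy.2 hx₁' hD).1
            have hm2 := hm.trans (mul_le_mul_of_nonneg_left
              (exp_sep_le hδ (sep_of_blk (ℓ := ℓ) (k := k) hy.2 hx₁' hD).2) hCM)
            rw [le_div_iff₀ hL]
            calc |L ^ (d + 1) * (L * (Gfine ℓ k M k a m2 ⟨y + Pi.single i 1, hye.1⟩ xe₁'
                    - Gfine ℓ k M k a m2 ⟨y + Pi.single i 1, hye.1⟩ x₁'))
                  - L ^ (d + 1) * (L * (Gfine ℓ k M k a m2 ⟨y, hy.1⟩ xe₁' - Gfine ℓ k M k a m2 ⟨y, hy.1⟩ x₁'))| * L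
                = L ^ (d + 1) * (L ^ 2 * |(Gfine ℓ k M k a m2 ⟨y + Pi.single i 1, hye.1⟩ xe₁'
                    - Gfine ℓ k M k a m2 ⟨y, hy.1⟩ xe₁')
                    - (Gfine ℓ k M k a m2 ⟨y + Pi.single i 1, hye.1⟩ x₁' - Gfine ℓ k M k a m2 ⟨y, hy.1⟩ x₁')|) := by
                  rw [← mul_sub, ← mul_sub, abs_mul, abs_mul, abs_of_pos hLp, abs_of_pos hL,
                    show ∀ p q r s : ℝ, (p - q) - (r - s) = (p - r) - (q - s) from fun p q r s => by ring]
                  ring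
              _ ≤ CM * E := hm2
          have hpath := abs_sub_le_supNorm (boxConvex_cube hb (Nf ℓ k M) v) g (by positivity) hstep
            ⟨x₁.2, hx₁⟩ ⟨x₂.2, hx₂⟩
          rw [hgy _ x₁.2, hgy _ x₂.2] at hpath
          calc _ ≤ CM * E / L * (((d : ℝ) + 1) * supNorm (x₂.1 - x₁.1)) := hpath
            _ = ((d : ℝ) + 1) * CM * E * t := by rw [htdef]; field_simp
            _ ≤ ((d : ℝ) + 1) * CM * E * t ^ α :=
                mul_le_mul_of_nonneg_left (le_rpow_of_le_one ht0 ht1 hα1.le) (by positivity)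
            _ ≤ (((d : ℝ) + 1) * CM + 2 * CD') * E * t ^ α := by
                have h01 : 0 ≤ 2 * CD' * (E * t ^ α) := by positivity
                have h02 : 0 ≤ ((d : ℝ) + 1) * CM * (E * t ^ α) := by positivity
                nlinarith
            _ ≤ (((d : ℝ) + 1) * CM + 2 * CD') * E * P ^ α := mul_le_mul_of_nonneg_left htPα (by positivity)
        · push Not at ht1
          have h1 := (hDf' x₂ ν₁ x₁' xe₁' hxe₁ s21'.1).trans
            (mul_le_mul_of_nonneg_left (exp_sep_le hδ s21'.2) hCD')
          have h2 := (hDf' x₁ ν₁ x₁' xe₁' hxe₁ s11'.1).trans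
            (mul_le_mul_of_nonneg_left (exp_sep_le hδ s11'.2) hCD')
          have h1α : 1 ≤ t ^ α := Real.one_le_rpow ht1.le hα0
          calc _ ≤ |L ^ (d + 1) * (L * (Gfine ℓ k M k a m2 x₂ xe₁' - Gfine ℓ k M k a m2 x₂ x₁'))|
                + |L ^ (d + 1) * (L * (Gfine ℓ k M k a m2 x₁ xe₁' - Gfine ℓ k M k a m2 x₁ x₁'))| := abs_sub _ _
            _ = L ^ (d + 1) * (L * |Gfine ℓ k M k a m2 x₂ xe₁' - Gfine ℓ k M k a m2 x₂ x₁'|)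
                + L ^ (d + 1) * (L * |Gfine ℓ k M k a m2 x₁ xe₁' - Gfine ℓ k M k a m2 x₁ x₁'|) := by
                rw [abs_mul, abs_mul, abs_of_pos hLp, abs_of_pos hL, abs_mul, abs_mul, abs_of_pos hLp, abs_of_pos hL]
            _ ≤ CD' * E + CD' * E := add_le_add h1 h2
            _ = 2 * CD' * E * 1 := by ring
            _ ≤ 2 * CD' * E * t ^ α := mul_le_mul_of_nonneg_left h1α (by positivity)
            _ ≤ (((d : ℝ) + 1) * CM + 2 * CD') * E * t ^ α := by
                have h01 : 0 ≤ 2 * CD' * (E * t ^ α) := by positivity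
                have h02 : 0 ≤ ((d : ℝ) + 1) * CM * (E * t ^ α) := by positivity
                nlinarith
            _ ≤ (((d : ℝ) + 1) * CM + 2 * CD') * E * P ^ α := mul_le_mul_of_nonneg_left htPα (by positivity)
    calc |L ^ (d + 1) * (L * (Gfine ℓ k M k a m2 x₂ xe₂' - Gfine ℓ k M k a m2 x₂ x₂'))
          - L ^ (d + 1) * (L * (Gfine ℓ k M k a m2 x₁ xe₁' - Gfine ℓ k M k a m2 x₁ x₁'))|
        ≤ |L ^ (d + 1) * (L * (Gfine ℓ k M k a m2 x₂ xe₂' - Gfine ℓ k M k a m2 x₂ x₂'))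
            - L ^ (d + 1) * (L * (Gfine ℓ k M k a m2 x₂ xe₁' - Gfine ℓ k M k a m2 x₂ x₁'))|
          + |L ^ (d + 1) * (L * (Gfine ℓ k M k a m2 x₂ xe₁' - Gfine ℓ k M k a m2 x₂ x₁'))
            - L ^ (d + 1) * (L * (Gfine ℓ k M k a m2 x₁ xe₁' - Gfine ℓ k M k a m2 x₁ x₁'))| := abs_sub_le _ _ _
      _ ≤ CH' * E * P ^ α + (((d : ℝ) + 1) * CM + 2 * CD') * E * P ^ α := add_le_add T1 T2
      _ = (CH' + ((d : ℝ) + 1) * CM + 2 * CD') * E * P ^ α := by ring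
      _ ≤ _ := by
          have : 0 ≤ E * P ^ α := by positivity
          nlinarith

end Parts


/-! ## §5 (3.1) DISCHARGED for the model instance, for each Hölder exponent `0 ≤ α < 1` -/

set_option maxHeartbeats 800000 in
/-- **B3 (3.1) p. 432 [PDF 22] — `‖hG_k(Ω,B̃)h′‖_{1,α} ≤ O(1)e^{−δ₀dist(□(v),□(v′))}` — PROVED for the MODEL INSTANCE `A = B̃ = 0`,
`Ω = □`, `h, h′` the unit-cube localizations of p. 420, `‖·‖_{1,α}` the printed (1.32) of the two-variable field:** for every
`0 ≤ α < 1` there are `δ₀ = δ₀(α) > 0`, `C = C(α) > 0` (depending on `d`, `L = ℓ + 1`, the window `[a₋,a₊] × [0,m²₊]` and `α` —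
the print's O(1) depends on the fixed `α` through Proposition I.2.1, «c₀ on α also») such that for every scale `k ≥ 1`
(`η = L^{−k}`), every point of the window and every box `□ = Π_i[0,M_i)` of unit blocks, the typed statement
`(sect3ZeroBox ℓ k M a m2).Ineq31 α δ₀ C` holds, i.e. for all unit cubes `□(v), □(v′)` with `dist(□(v),□(v′)) ≥ 1`:
`‖1_{□(v)}G^η_k(□,0)1_{□(v′)}‖_{1,α} ≤ C·e^{−δ₀·dist(□(v),□(v′))}`.  Print: *"Such a possibility is assured by the following estimates
‖hG_k(Ω,B̃)h′‖_{1,α} ≤ O(1)e^{−δ₀dist(□(v),□(v′))}, (3.1) and similarly for the vector field propagator, h, h′ are localization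
functions."*  Route: the three parts of (1.32) (`supPart_le`, `derivPart_le`, `holderPart_le`) fed with the six kernel clauses of
`B3GkZeroBoxSeparated` at separation `ρ = 1` and the common rate `δ₀ = min δᵢ`. [cite: Balaban1983Higgs3, (3.1) p.432] -/
theorem ineq31_zeroBox (d ℓ : ℕ) (hℓ : 1 ≤ ℓ) (amin aplus m2plus : ℝ) (ha : 0 < amin) {α : ℝ} (hα0 : 0 ≤ α)
    (hα1 : α < 1) :
    ∃ δ₀ C : ℝ, 0 < δ₀ ∧ 0 < C ∧ ∀ (k : ℕ), 1 ≤ k → ∀ (a m2 : ℝ), amin ≤ a → a ≤ aplus → 0 ≤ m2 → m2 ≤ m2plus →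
      ∀ (M : Fin (d + 1) → ℕ), (∀ i, 1 ≤ M i) → (sect3ZeroBox ℓ k M a m2).Ineq31 α δ₀ C := by
  obtain ⟨δ1, CV, hδ1, hCV, hV⟩ := abs_Gk_sep_le d ℓ hℓ amin aplus m2plus ha one_pos
  obtain ⟨δ2, CD, hδ2, hCD, hDf⟩ := abs_GkDiff_sep_le d ℓ hℓ amin aplus m2plus ha one_pos
  obtain ⟨δ3, CD', hδ3, hCD', hDf'⟩ := abs_GkDiff'_sep_le d ℓ hℓ amin aplus m2plus ha one_pos
  obtain ⟨δ4, CH, hδ4, hCH, hH⟩ := abs_GkDD_sep_le d ℓ hℓ amin aplus m2plus ha hα0 hα1 one_pos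
  obtain ⟨δ5, CH', hδ5, hCH', hH'⟩ := abs_GkDD'_sep_le d ℓ hℓ amin aplus m2plus ha hα0 hα1 one_pos
  obtain ⟨δ6, CM, hδ6, hCM, hMx⟩ := abs_GkMixed_sep_le d ℓ hℓ amin aplus m2plus ha one_pos
  set δ₀ : ℝ := min (min (min δ1 δ2) (min δ3 δ4)) (min δ5 δ6) with hδ₀def
  have hδ₀ : 0 < δ₀ := lt_min (lt_min (lt_min hδ1 hδ2) (lt_min hδ3 hδ4)) (lt_min hδ5 hδ6)
  have l12 : δ₀ ≤ min δ1 δ2 := (min_le_left _ _).trans (min_le_left _ _)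
  have l34 : δ₀ ≤ min δ3 δ4 := (min_le_left _ _).trans (min_le_right _ _)
  have l56 : δ₀ ≤ min δ5 δ6 := min_le_right _ _
  have l1 : δ₀ ≤ δ1 := l12.trans (min_le_left _ _)
  have l2 : δ₀ ≤ δ2 := l12.trans (min_le_right _ _)
  have l3 : δ₀ ≤ δ3 := l34.trans (min_le_left _ _)
  have l4 : δ₀ ≤ δ4 := l34.trans (min_le_right _ _)
  have l5 : δ₀ ≤ δ5 := l56.trans (min_le_left _ _)
  have l6 : δ₀ ≤ δ6 := l56.trans (min_le_right _ _)
  have hd1 : (0 : ℝ) ≤ (d : ℝ) + 1 := by positivity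
  refine ⟨δ₀, CV + (CD + CD') + ((CH + ((d : ℝ) + 1) * CM + 2 * CD) + (CH' + ((d : ℝ) + 1) * CM + 2 * CD')), hδ₀,
    by positivity, ?_⟩
  intro k hk a m2 h1 h2 h3 h4 M hM
  rw [ineq31_iff]
  intro v v' hD
  have hL : (0 : ℝ) < ((((ℓ + 1) ^ k : ℕ)) : ℝ) := by positivity
  have hn : ∀ z : Fin (d + 1) → ℤ, 0 ≤ supNorm z / ((((ℓ + 1) ^ k : ℕ)) : ℝ) := fun z =>
    div_nonneg (supNorm_nonneg _) hL.le
  have hnm : ∀ z z' : Fin (d + 1) → ℤ, 0 ≤ min (supNorm z) (supNorm z') / ((((ℓ + 1) ^ k : ℕ)) : ℝ) := fun z z' =>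
    div_nonneg (le_min (supNorm_nonneg _) (supNorm_nonneg _)) hL.le
  -- the six clauses at the window point, weakened to the common rate `δ₀`
  have P1 := supPart_le (ℓ := ℓ) (k := k) (M := M) (a := a) (m2 := m2) hδ₀.le hCV.le
    (fun x x' hs => (hV k hk a m2 h1 h2 h3 h4 M hM x x' hs).trans
      (mul_le_mul_of_nonneg_left (exp_rate_mono l1 (hn _)) hCV.le)) hD
  have hDfw : ∀ (μ : Fin (d + 1)) (x xe : ↥(boxDom (Nf ℓ k M))), xe.1 = x.1 + Pi.single μ 1 →
      ∀ (x' : ↥(boxDom (Nf ℓ k M))), 1 * ((((ℓ + 1) ^ k : ℕ)) : ℝ) ≤ supNorm (x.1 - x'.1) →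
        ((((ℓ + 1) ^ k : ℕ)) : ℝ) ^ (d + 1) *
            (((((ℓ + 1) ^ k : ℕ)) : ℝ) * |Gfine ℓ k M k a m2 xe x' - Gfine ℓ k M k a m2 x x'|)
          ≤ CD * Real.exp (-(δ₀ * (supNorm (x.1 - x'.1) / ((((ℓ + 1) ^ k : ℕ)) : ℝ)))) :=
    fun μ x xe hxe x' hs => (hDf k hk a m2 h1 h2 h3 h4 M hM μ x xe hxe x' hs).trans
      (mul_le_mul_of_nonneg_left (exp_rate_mono l2 (hn _)) hCD.le)
  have hDf'w : ∀ (x : ↥(boxDom (Nf ℓ k M))) (ν : Fin (d + 1)) (x' xe' : ↥(boxDom (Nf ℓ k M))),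
      xe'.1 = x'.1 + Pi.single ν 1 → 1 * ((((ℓ + 1) ^ k : ℕ)) : ℝ) ≤ supNorm (x.1 - x'.1) →
        ((((ℓ + 1) ^ k : ℕ)) : ℝ) ^ (d + 1) *
            (((((ℓ + 1) ^ k : ℕ)) : ℝ) * |Gfine ℓ k M k a m2 x xe' - Gfine ℓ k M k a m2 x x'|)
          ≤ CD' * Real.exp (-(δ₀ * (supNorm (x.1 - x'.1) / ((((ℓ + 1) ^ k : ℕ)) : ℝ)))) :=
    fun x ν x' xe' hxe' hs => (hDf' k hk a m2 h1 h2 h3 h4 M hM x ν x' xe' hxe' hs).trans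
      (mul_le_mul_of_nonneg_left (exp_rate_mono l3 (hn _)) hCD'.le)
  have hHw : ∀ (μ : Fin (d + 1)) (x₁ xe₁ x₂ xe₂ : ↥(boxDom (Nf ℓ k M))), xe₁.1 = x₁.1 + Pi.single μ 1 →
      xe₂.1 = x₂.1 + Pi.single μ 1 → x₂.1 ≠ x₁.1 → ∀ (x : ↥(boxDom (Nf ℓ k M))),
      1 * ((((ℓ + 1) ^ k : ℕ)) : ℝ) ≤ min (supNorm (x₁.1 - x.1)) (supNorm (x₂.1 - x.1)) →
        ((((ℓ + 1) ^ k : ℕ) : ℝ) / supNorm (x₂.1 - x₁.1)) ^ α *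
            (((((ℓ + 1) ^ k : ℕ)) : ℝ) ^ (d + 1) *
              ((((ℓ + 1) ^ k : ℕ) : ℝ) * |(Gfine ℓ k M k a m2 xe₂ x - Gfine ℓ k M k a m2 x₂ x)
                - (Gfine ℓ k M k a m2 xe₁ x - Gfine ℓ k M k a m2 x₁ x)|))
          ≤ CH * Real.exp (-(δ₀ * (min (supNorm (x₁.1 - x.1)) (supNorm (x₂.1 - x.1)) / ((((ℓ + 1) ^ k : ℕ)) : ℝ)))) :=
    fun μ x₁ xe₁ x₂ xe₂ hxe₁ hxe₂ hne x hs => (hH k hk a m2 h1 h2 h3 h4 M hM μ x₁ xe₁ x₂ xe₂ hxe₁ hxe₂ hne x hs).trans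
      (mul_le_mul_of_nonneg_left (exp_rate_mono l4 (hnm _ _)) hCH.le)
  have hH'w : ∀ (x : ↥(boxDom (Nf ℓ k M))) (ν : Fin (d + 1)) (x₁' xe₁' x₂' xe₂' : ↥(boxDom (Nf ℓ k M))),
      xe₁'.1 = x₁'.1 + Pi.single ν 1 → xe₂'.1 = x₂'.1 + Pi.single ν 1 → x₂'.1 ≠ x₁'.1 →
      1 * ((((ℓ + 1) ^ k : ℕ)) : ℝ) ≤ min (supNorm (x.1 - x₁'.1)) (supNorm (x.1 - x₂'.1)) →
        ((((ℓ + 1) ^ k : ℕ) : ℝ) / supNorm (x₂'.1 - x₁'.1)) ^ α *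
            (((((ℓ + 1) ^ k : ℕ)) : ℝ) ^ (d + 1) *
              ((((ℓ + 1) ^ k : ℕ) : ℝ) * |(Gfine ℓ k M k a m2 x xe₂' - Gfine ℓ k M k a m2 x x₂')
                - (Gfine ℓ k M k a m2 x xe₁' - Gfine ℓ k M k a m2 x x₁')|))
          ≤ CH' * Real.exp (-(δ₀ * (min (supNorm (x.1 - x₁'.1)) (supNorm (x.1 - x₂'.1)) / ((((ℓ + 1) ^ k : ℕ)) : ℝ)))) :=
    fun x ν x₁' xe₁' x₂' xe₂' hxe₁ hxe₂ hne hs =>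
      (hH' k hk a m2 h1 h2 h3 h4 M hM x ν x₁' xe₁' x₂' xe₂' hxe₁ hxe₂ hne hs).trans
        (mul_le_mul_of_nonneg_left (exp_rate_mono l5 (hnm _ _)) hCH'.le)
  have hMxw : ∀ (μ ν : Fin (d + 1)) (x xe : ↥(boxDom (Nf ℓ k M))), xe.1 = x.1 + Pi.single μ 1 →
      ∀ (x' xe' : ↥(boxDom (Nf ℓ k M))), xe'.1 = x'.1 + Pi.single ν 1 →
      1 * ((((ℓ + 1) ^ k : ℕ)) : ℝ) ≤ supNorm (x.1 - x'.1) →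
        ((((ℓ + 1) ^ k : ℕ)) : ℝ) ^ (d + 1) *
            (((((ℓ + 1) ^ k : ℕ)) : ℝ) ^ 2 * |(Gfine ℓ k M k a m2 xe xe' - Gfine ℓ k M k a m2 x xe')
              - (Gfine ℓ k M k a m2 xe x' - Gfine ℓ k M k a m2 x x')|)
          ≤ CM * Real.exp (-(δ₀ * (supNorm (x.1 - x'.1) / ((((ℓ + 1) ^ k : ℕ)) : ℝ)))) :=
    fun μ ν x xe hxe x' xe' hxe' hs => (hMx k hk a m2 h1 h2 h3 h4 M hM μ ν x xe hxe x' xe' hxe' hs).trans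
      (mul_le_mul_of_nonneg_left (exp_rate_mono l6 (hn _)) hCM.le)
  have P2 := derivPart_le (ℓ := ℓ) (k := k) (M := M) (a := a) (m2 := m2) hδ₀.le hCD.le hCD'.le hDfw hDf'w hD
  have P3 := holderPart_le (ℓ := ℓ) (k := k) (M := M) (a := a) (m2 := m2) hα0 hα1 hδ₀.le hCD.le hCD'.le hCH.le
    hCH'.le hCM.le hDfw hDf'w hHw hH'w hMxw hD
  unfold normHGH norm132
  calc _ ≤ CV * Real.exp (-(δ₀ * cubeDist v v')) + (CD + CD') * Real.exp (-(δ₀ * cubeDist v v'))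
        + ((CH + ((d : ℝ) + 1) * CM + 2 * CD) + (CH' + ((d : ℝ) + 1) * CM + 2 * CD'))
          * Real.exp (-(δ₀ * cubeDist v v')) := add_le_add (add_le_add P1 P2) P3
    _ = _ := by ring

/-! ## §6 Non-vacuity: the binders are inhabited (`d + 1 = 3`, `L = 2`, window `[1/2, 2] × [0, 1]`, `α = 1/2`; at `k = 1`,
`a = 1`, `m² = 1/2`, the box of `4 × 4 × 4` unit cubes the statement `Ineq31` is a genuine family of real inequalities) -/

/-- The constants of `ineq31_zeroBox` exist and (3.1) holds for an explicit instance of the carrier.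
[cite: Balaban1983Higgs3, (3.1) p.432] -/
theorem ineq31_zeroBox_witness :
    ∃ δ₀ C : ℝ, 0 < δ₀ ∧ 0 < C ∧
      (sect3ZeroBox 1 1 (fun _ : Fin 3 => 4) (1 : ℝ) (1 / 2 : ℝ)).Ineq31 (1 / 2) δ₀ C := by
  obtain ⟨δ₀, C, hδ₀, hC, h⟩ :=
    ineq31_zeroBox 2 1 le_rfl (1 / 2) 2 1 (by norm_num) (α := 1 / 2) (by norm_num) (by norm_num)
  exact ⟨δ₀, C, hδ₀, hC,
    h 1 le_rfl 1 (1 / 2) (by norm_num) (by norm_num) (by norm_num) (by norm_num) _ (fun _ => by norm_num)⟩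

end

end Literature.MathematicalPhysics.QuantumFieldTheory.Balaban1983to89.B3Ineq31ZeroBox
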